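import Summits.CriticalPhenomena.CardyFormulaZ2.Theorems.CardyBoundaryCoulombGasRectilinearCardyStubRowBlocksPart10
import Summits.CriticalPhenomena.CardyFormulaZ2.Theorems.CardyBoundaryCoulombGasRectilinearCardyStubRowBlocksPart11
import Summits.CriticalPhenomena.CardyFormulaZ2.Theorems.CardyBoundaryCoulombGasRectilinearCardyStubRowBlocksPart17
import Summits.CriticalPhenomena.CardyFormulaZ2.Theorems.CardyBoundaryCoulombGasBoundaryDefectGaussianRStubRealisabilityPart47
import Summits.CriticalPhenomena.CardyFormulaZ2.Theorems.RectilinearCardy.Negative.RectilinearCardyReductions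
import HarnessLib

/-!
# Stub B `stub_rowBlocks` of line `excursion-kernel-covariance`: assembly
# (crux `RectilinearCardy`, stmt-CriticalPhenomena-5660, route `CardyBoundaryCoulombGas`)

The ROW BLOCKS stub of the skeleton `Cruxes/RectilinearCardy/Lines/excursion_kernel_covariance.lean`
(reshape c4-1), verbatim, assembled from its seventeen parts: the continuum data of the reversed
(positively oriented) domain `D` of the clockwise flat-marked conformal rectangle `R` along the
admissible window (`rb_continuum`, part 16), the BOUNDARY FEET hypothesis applied to `D` at a small
mesh and re-started at the exterior dart `d₀ = (X, k₀)` of the `d`-side row neighbour `X` of `v`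
(`rb_window_anchor`, `rb_cycle_shift`, part 17), the two blocks along the cycle (`rb_main_blocks`,
part 10), the row-set / corner / distinctness clauses (`rb_main_clauses`, part 11, with the range-`3`
lattice charts `ec_chart_of_small` of the engine line and the dictionary `rb_rowArc_iff`,
`rb_rowBeyond_iff` of part 15), and the transcription lemmas of parts 2 and 9 (`rb_iterate_eq`,
`rb_period_eq`, `rb_sep_of_far`, `rb_flat_at`); `rb_far_of_sep` is the landing anchor (a centre far from
the foot of `X` is far from `X`).

All [folklore].
-/

noncomputable section

open Set Metric
open Literature.Probability.RandomPlanarGeometry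
open Literature.Probability.LatticeModels (Site meshPoint Orient)
open Literature.Probability.LatticeModels.CollarLegModel (Dart dartTip dir dsucc outDart period neighbours)
open Summit.CriticalPhenomena.CardyFormulaZ2.Theorems.RectilinearCardy.Negative (IsRectilinear)
open Summit.CriticalPhenomena.CardyFormulaZ2.Cruxes.BoundaryDefectGaussianR.RainbowMonomialsInExcursionKernels
  (ec_uniform_closure_chart ec_chart_of_small)

namespace Summit.CriticalPhenomena.CardyFormulaZ2.Cruxes.RectilinearCardy.ExcursionKernelCovariance

/-- **A centre far from the foot of `X` is far from `X`**: if the mesh point of `X` is within `2δ`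
of a point `p` and `c` is `r`-far from `p` (`40δ ≤ r`), then `c` is `r/2`-far from the mesh point of
`X`. [folklore] -/
theorem rb_far_of_sep {δ r : ℝ} {X : ℤ × ℤ} {p c : ℂ} (hrδ : 40 * δ ≤ r)
    (hX : dist (meshPoint δ (![X.1, X.2] : Site 2)) p < 2 * δ) (hc : r ≤ dist c p) :
    r / 2 ≤ dist (meshPoint δ (![X.1, X.2] : Site 2)) c := by
  have h1 := dist_triangle c (meshPoint δ (![X.1, X.2] : Site 2)) p
  have h2 := dist_comm c (meshPoint δ (![X.1, X.2] : Site 2))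
  have h3 : (0 : ℝ) ≤ δ := by
    have := dist_nonneg (x := meshPoint δ (![X.1, X.2] : Site 2)) (y := p); linarith
  linarith

/-- **Stub B — ROW BLOCKS.** Given the boundary-feet theorem (stub W, as a hypothesis), for a
CLOCKWISE rectilinear flat-marked `R` and an admissible range `[σ, σ']`: for all small meshes and
every boundary-row vertex `v` within `ρ` of the window, the exterior dart `d₀` of the `d`-side row
neighbour `X` of `v` starts a boundary cycle `e i = dsucc^[i] d₀` on which `e 1` sits at `v`, the row
vertices of `rowArc` occupy exactly one block `[iA, iB]` (ends `A ≈ b`, `B ≈ a`) and those of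
`rowBeyond v` the final block `[iC, P)` (`C ≈ d`) together with `X`; the other vertices of the blocks
are lattice convex corners all of whose polygon neighbours are row vertices of the same block;
`X, A, B, C` are row vertices, pairwise `ℓ∞`-separated, macroscopically flat, within `4δ` of
`v, b, a, d`. [folklore] -/
theorem stub_rowBlocks :
    (∀ (D : Literature.Probability.RandomPlanarGeometry.JordanDomain),
      (∃ S : Finset (ℂ × ℂ), (∀ q ∈ S, q.1.re = q.2.re ∨ q.1.im = q.2.im) ∧
        frontier D.carrier ⊆ ⋃ q ∈ S, segment ℝ q.1 q.2) →
      (∃ t₁ : ℝ, ∃ τ : ℂ, ‖τ‖ = 1 ∧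
        (∃ ε : ℝ, 0 < ε ∧ ∀ t ∈ Ioo t₁ (t₁ + ε), ∃ s : ℝ, 0 < s ∧ D.boundary t = D.boundary t₁ + (s : ℂ) * τ) ∧
        (∃ ε : ℝ, 0 < ε ∧ ∀ s ∈ Ioo (0 : ℝ) ε, D.boundary t₁ + (s : ℂ) * (τ * Complex.I) ∈ D.carrier)) →
      ∀ η : ℝ, 0 < η → ∃ δ₀ : ℝ, 0 < δ₀ ∧ ∀ δ : ℝ, 0 < δ → δ < δ₀ →
        ∀ V : Finset (ℤ × ℤ),
          (∀ v : ℤ × ℤ, v ∈ V ↔ ((v.1 : ℂ) * δ + (v.2 : ℂ) * δ * Complex.I) ∈ closure D.carrier) →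
          ∃ (P : ℕ) (e : ℕ → Literature.Probability.LatticeModels.CollarLegModel.Dart) (F : ℕ → ℝ),
            0 < P ∧ (∀ n, e (n + P) = e n) ∧
            (∀ n, e (n + 1) = Literature.Probability.LatticeModels.CollarLegModel.dsucc V (e n)) ∧
            (∀ n, (e n).1 ∈ V ∧ Literature.Probability.LatticeModels.CollarLegModel.dartTip (e n) ∉ V) ∧
            (∀ d : Literature.Probability.LatticeModels.CollarLegModel.Dart, d.1 ∈ V →
              Literature.Probability.LatticeModels.CollarLegModel.dartTip d ∉ V → ∃ n, n < P ∧ e n = d) ∧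
            (∀ n m, n < P → m < P → e n = e m → n = m) ∧
            (∀ n, F n ≤ F (n + 1)) ∧ (∀ n, F (n + 1) < F n + η) ∧ (∀ n, F (n + P) = F n + 1) ∧
            (∀ n, dist (D.boundary (F n)) (((e n).1.1 : ℂ) * δ + ((e n).1.2 : ℂ) * δ * Complex.I) ≤ η) ∧
            (∀ n, ∀ ρ : ℝ, 4 * δ ≤ ρ →
              ((∀ z ∈ frontier D.carrier, dist z (((e n).1.1 : ℂ) * δ + ((e n).1.2 : ℂ) * δ * Complex.I) < ρ →
                  z.im = (((e n).1.1 : ℂ) * δ + ((e n).1.2 : ℂ) * δ * Complex.I).im) ∨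
                (∀ z ∈ frontier D.carrier, dist z (((e n).1.1 : ℂ) * δ + ((e n).1.2 : ℂ) * δ * Complex.I) < ρ →
                  z.re = (((e n).1.1 : ℂ) * δ + ((e n).1.2 : ℂ) * δ * Complex.I).re)) →
              ∃ s : ℝ, 0 ≤ s ∧ s ≤ δ ∧
                D.boundary (F n) = (((e n).1.1 : ℂ) * δ + ((e n).1.2 : ℂ) * δ * Complex.I) +
                  (s : ℂ) * (((Literature.Probability.LatticeModels.CollarLegModel.dir (e n).2).1 : ℂ) +
                    ((Literature.Probability.LatticeModels.CollarLegModel.dir (e n).2).2 : ℂ) * Complex.I)) ∧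
            (∀ n, ((Literature.Probability.LatticeModels.CollarLegModel.neighbours (e n).1).filter
              (fun y ↦ y ∉ V)).card ≤ 2) ∧
            (∀ n, (e (n + 2)).1 = (e (n + 1)).1 →
              (e (n + 2)).2 = (e (n + 1)).2 + 1 ∧
              e n = ((e (n + 1)).1 + Literature.Probability.LatticeModels.CollarLegModel.dir ((e (n + 1)).2 + 3),
                (e (n + 1)).2) ∧
              e (n + 3) = ((e (n + 1)).1 + Literature.Probability.LatticeModels.CollarLegModel.dir ((e (n + 1)).2 + 2),
                (e (n + 1)).2 + 1) ∧
              ((Literature.Probability.LatticeModels.CollarLegModel.neighbours (e n).1).filter (fun y ↦ y ∉ V)).card = 1 ∧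
              ((Literature.Probability.LatticeModels.CollarLegModel.neighbours (e (n + 3)).1).filter
                (fun y ↦ y ∉ V)).card = 1)) →
    ∀ R : ConformalRectangle, IsRectilinear R → FlatMarks R →
      (∃ u : ℂ, (u = 1 ∨ u = Complex.I ∨ u = -1 ∨ u = -Complex.I) ∧ ∃ r : ℝ, 0 < r ∧
        (∀ t t' : ℝ, R.mark 0 - r < t → t < t' → t' < R.mark 0 + r →
          0 < ((R.boundary t' - R.boundary t) / u).re ∧ ((R.boundary t' - R.boundary t) / u).im = 0) ∧
        (∀ z : ℂ, dist z (R.pt 0) < r → (z ∈ R.carrier ↔ 0 < -((z - R.pt 0) / u).im))) →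
      ∀ σ σ' : ℝ, AdmissibleRange R σ σ' →
        ∃ ρ : ℝ, 0 < ρ ∧ ∃ δ₁ : ℝ, 0 < δ₁ ∧ ∀ δ : ℝ, 0 < δ → δ < δ₁ →
          ∀ v ∈ boundaryRow R δ, (∃ τ ∈ Icc σ σ', dist (meshPoint δ v) (R.boundary τ) ≤ ρ) →
          ∀ V : Finset (ℤ × ℤ),
            (∀ x : ℤ × ℤ, x ∈ V ↔ ((x.1 : ℂ) * δ + (x.2 : ℂ) * δ * Complex.I) ∈ closure R.carrier) →
          ∀ v' : ℤ × ℤ, v' = (v 0, v 1) →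
          ∃ (d₀ : Literature.Probability.LatticeModels.CollarLegModel.Dart) (iA iB iC : ℕ),
            (d₀.1 ∈ V ∧ Literature.Probability.LatticeModels.CollarLegModel.dartTip d₀ ∉ V ∧ Literature.Probability.LatticeModels.CollarLegModel.outDart V d₀.1 = some d₀) ∧
            ((Literature.Probability.LatticeModels.CollarLegModel.dsucc V d₀).1 = v') ∧
            (2 ≤ iA ∧ iA ≤ iB ∧ iB + 2 ≤ iC ∧ iC + 2 ≤ Literature.Probability.LatticeModels.CollarLegModel.period V d₀) ∧
            (((Literature.Probability.LatticeModels.CollarLegModel.neighbours d₀.1).filter (fun y ↦ y ∉ V)).card = 1 ∧ ((Literature.Probability.LatticeModels.CollarLegModel.neighbours ((Literature.Probability.LatticeModels.CollarLegModel.dsucc V)^[iA] d₀).1).filter (fun y ↦ y ∉ V)).card = 1 ∧ ((Literature.Probability.LatticeModels.CollarLegModel.neighbours ((Literature.Probability.LatticeModels.CollarLegModel.dsucc V)^[iB] d₀).1).filter (fun y ↦ y ∉ V)).card = 1 ∧ ((Literature.Probability.LatticeModels.CollarLegModel.neighbours ((Literature.Probability.LatticeModels.CollarLegModel.dsucc V)^[iC]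 d₀).1).filter (fun y ↦ y ∉ V)).card = 1 ∧ ((Literature.Probability.LatticeModels.CollarLegModel.neighbours v').filter (fun y ↦ y ∉ V)).card = 1) ∧
            ((3 : ℤ) ≤ max |(d₀.1).1 - (((Literature.Probability.LatticeModels.CollarLegModel.dsucc V)^[iA] d₀).1).1| |(d₀.1).2 - (((Literature.Probability.LatticeModels.CollarLegModel.dsucc V)^[iA] d₀).1).2| ∧ (3 : ℤ) ≤ max |(d₀.1).1 - (((Literature.Probability.LatticeModels.CollarLegModel.dsucc V)^[iB] d₀).1).1| |(d₀.1).2 - (((Literature.Probability.LatticeModels.CollarLegModel.dsucc V)^[iB] d₀).1).2| ∧ (3 : ℤ) ≤ max |(d₀.1).1 - (((Literature.Probability.LatticeModels.CollarLegModel.dsucc V)^[iC] d₀).1).1| |(d₀.1).2 - (((Literature.Probability.LatticeModels.CollarLegModel.dsucc V)^[iC] d₀).1).2| ∧ (3 : ℤ) ≤ max |(((Literature.Probability.LatticeModels.CollarLegModel.dsucc V)^[iA] d₀).1).1 - (((Literature.Probability.LatticeModels.CollarLegModel.dsucc V)^[iB] d₀).1).1| |(((Literature.Probability.LatticeModels.CollarLegModel.dsucc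 V)^[iA] d₀).1).2 - (((Literature.Probability.LatticeModels.CollarLegModel.dsucc V)^[iB] d₀).1).2| ∧ (3 : ℤ) ≤ max |(((Literature.Probability.LatticeModels.CollarLegModel.dsucc V)^[iA] d₀).1).1 - (((Literature.Probability.LatticeModels.CollarLegModel.dsucc V)^[iC] d₀).1).1| |(((Literature.Probability.LatticeModels.CollarLegModel.dsucc V)^[iA] d₀).1).2 - (((Literature.Probability.LatticeModels.CollarLegModel.dsucc V)^[iC] d₀).1).2| ∧ (3 : ℤ) ≤ max |(((Literature.Probability.LatticeModels.CollarLegModel.dsucc V)^[iB] d₀).1).1 - (((Literature.Probability.LatticeModels.CollarLegModel.dsucc V)^[iC] d₀).1).1| |(((Literature.Probability.LatticeModels.CollarLegModel.dsucc V)^[iB] d₀).1).2 - (((Literature.Probability.LatticeModels.CollarLegModel.dsucc V)^[iC] d₀).1).2|) ∧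
            (∀ x : ℤ × ℤ, (∃ y ∈ rowArc R δ, ((y 0, y 1) : ℤ × ℤ) = x) ↔
              ∃ i : ℕ, iA ≤ i ∧ i ≤ iB ∧ ((Literature.Probability.LatticeModels.CollarLegModel.dsucc V)^[i] d₀).1 = x ∧ ((Literature.Probability.LatticeModels.CollarLegModel.neighbours ((Literature.Probability.LatticeModels.CollarLegModel.dsucc V)^[i] d₀).1).filter (fun y ↦ y ∉ V)).card = 1) ∧
            (∀ x : ℤ × ℤ, (∃ y ∈ rowBeyond R δ v, ((y 0, y 1) : ℤ × ℤ) = x) ↔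
              (∃ i : ℕ, iC ≤ i ∧ i < Literature.Probability.LatticeModels.CollarLegModel.period V d₀ ∧ ((Literature.Probability.LatticeModels.CollarLegModel.dsucc V)^[i] d₀).1 = x ∧ ((Literature.Probability.LatticeModels.CollarLegModel.neighbours ((Literature.Probability.LatticeModels.CollarLegModel.dsucc V)^[i] d₀).1).filter (fun y ↦ y ∉ V)).card = 1) ∨ x = d₀.1) ∧
            (∀ i : ℕ, iA ≤ i → i ≤ iB → ((Literature.Probability.LatticeModels.CollarLegModel.neighbours ((Literature.Probability.LatticeModels.CollarLegModel.dsucc V)^[i] d₀).1).filter (fun y ↦ y ∉ V)).card ≠ 1 →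
              ∀ w ∈ V, (w.1 - ((Literature.Probability.LatticeModels.CollarLegModel.dsucc V)^[i] d₀).1.1) ^ 2 + (w.2 - ((Literature.Probability.LatticeModels.CollarLegModel.dsucc V)^[i] d₀).1.2) ^ 2 = 1 → (∃ y ∈ rowArc R δ, ((y 0, y 1) : ℤ × ℤ) = w)) ∧
            (∀ i : ℕ, iC ≤ i → i < Literature.Probability.LatticeModels.CollarLegModel.period V d₀ → ((Literature.Probability.LatticeModels.CollarLegModel.neighbours ((Literature.Probability.LatticeModels.CollarLegModel.dsucc V)^[i] d₀).1).filter (fun y ↦ y ∉ V)).card ≠ 1 →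
              ∀ w ∈ V, (w.1 - ((Literature.Probability.LatticeModels.CollarLegModel.dsucc V)^[i] d₀).1.1) ^ 2 + (w.2 - ((Literature.Probability.LatticeModels.CollarLegModel.dsucc V)^[i] d₀).1.2) ^ 2 = 1 → (∃ y ∈ rowBeyond R δ v, ((y 0, y 1) : ℤ × ℤ) = w)) ∧
            (∀ i : ℕ, iA ≤ i → i ≤ iB → ((Literature.Probability.LatticeModels.CollarLegModel.dsucc V)^[i] d₀).1 ≠ v' ∧ ((Literature.Probability.LatticeModels.CollarLegModel.dsucc V)^[i] d₀).1 ≠ d₀.1 ∧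
              ∀ j : ℕ, iC ≤ j → j < Literature.Probability.LatticeModels.CollarLegModel.period V d₀ → ((Literature.Probability.LatticeModels.CollarLegModel.dsucc V)^[i] d₀).1 ≠ ((Literature.Probability.LatticeModels.CollarLegModel.dsucc V)^[j] d₀).1) ∧
            (d₀.1 ≠ v') ∧
            (dist (((d₀.1).1 : ℂ) * δ + ((d₀.1).2 : ℂ) * δ * Complex.I) (meshPoint δ v) ≤ δ ∧ dist (((((Literature.Probability.LatticeModels.CollarLegModel.dsucc V)^[iA] d₀).1).1 : ℂ) * δ + ((((Literature.Probability.LatticeModels.CollarLegModel.dsucc V)^[iA] d₀).1).2 : ℂ) * δ * Complex.I) (R.pt 1) ≤ 4 * δ ∧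
              dist (((((Literature.Probability.LatticeModels.CollarLegModel.dsucc V)^[iB] d₀).1).1 : ℂ) * δ + ((((Literature.Probability.LatticeModels.CollarLegModel.dsucc V)^[iB] d₀).1).2 : ℂ) * δ * Complex.I) (R.pt 0) ≤ 4 * δ ∧ dist (((((Literature.Probability.LatticeModels.CollarLegModel.dsucc V)^[iC] d₀).1).1 : ℂ) * δ + ((((Literature.Probability.LatticeModels.CollarLegModel.dsucc V)^[iC] d₀).1).2 : ℂ) * δ * Complex.I) (R.pt 3) ≤ 4 * δ) ∧
            (∀ x ∈ ({d₀.1, ((Literature.Probability.LatticeModels.CollarLegModel.dsucc V)^[iA] d₀).1, ((Literature.Probability.LatticeModels.CollarLegModel.dsucc V)^[iB] d₀).1, ((Literature.Probability.LatticeModels.CollarLegModel.dsucc V)^[iC] d₀).1} : Finset (ℤ × ℤ)), ∃ dvec : ℤ × ℤ,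
              (dvec = (1, 0) ∨ dvec = (-1, 0) ∨ dvec = (0, 1) ∨ dvec = (0, -1)) ∧
              ∀ w : ℤ × ℤ, ((((w.1 - x.1) ^ 2 + (w.2 - x.2) ^ 2 : ℤ) : ℝ)) ≤ (ρ / δ) ^ 2 →
                (w ∈ V ↔ 0 ≤ (w.1 - x.1) * dvec.1 + (w.2 - x.2) * dvec.2)) := by
  intro hW R hRect hFlat hcw σ σ' hadm
  -- the continuum data
  obtain ⟨D, σ₂, σ₂', tb, ta, td, ow, ob, oa, od, Hw, r, θ, θ', ε₂, m₂, sTw, sTb, sTa, sTd, hDc, hDb, ⟨htb, hta, htd⟩,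
    ⟨hDb1, hDa0, hDd3⟩, ⟨h1₂, hσ₂σ, _, hσ'σ₂', h3₂⟩, ⟨hθ, _, hg1, hg2, hg3, hg4⟩, ⟨hr, hε₂, hε₂θ', hθ'θ, hm₂, hm₂r⟩,
    hunif, htube, hclR, hopR, ⟨hclb, hopb⟩, ⟨hcla, hopa⟩, ⟨hcld, hopd⟩, ⟨hsTw, hsTb, hsTa, hsTd⟩, hTb, hTa, hTd,
    ⟨hsba, hsad, hsbd⟩, hAb, hAa, hCne₁, hwin⟩ := rb_continuum R hFlat hadm
  obtain ⟨kw, sw, dvw, hsw, hdvw, htabw, hk₀w, hdw⟩ := rb_orient_table ow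
  obtain ⟨kb, sb, dvb, hsb, hdvb, htabb, hk₀b, hdb⟩ := rb_orient_table ob
  obtain ⟨ka, sa, dva, hsa, hdva, htaba, hk₀a, hda⟩ := rb_orient_table oa
  obtain ⟨kd, sd, dvd, hsd, hdvd, htabd, hk₀d, hdd⟩ := rb_orient_table od
  -- rectilinearity and orientation of `D`, the uniform charts, the boundary-feet cycles
  have hrectD : ∃ S : Finset (ℂ × ℂ), (∀ q ∈ S, q.1.re = q.2.re ∨ q.1.im = q.2.im) ∧
      frontier D.carrier ⊆ ⋃ q ∈ S, segment ℝ q.1 q.2 := by rw [hDc]; exact hRect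
  obtain ⟨r₀, hr₀, hcharts⟩ := ec_uniform_closure_chart D hrectD
  obtain ⟨rz, hrz0, hrzr, hrzm⟩ : ∃ rz : ℝ, 0 < rz ∧ rz ≤ r / 8 ∧ rz ≤ m₂ / 2 :=
    ⟨min (r / 8) (m₂ / 2), lt_min (by positivity) (by positivity), min_le_left _ _, min_le_right _ _⟩
  obtain ⟨δ₀, hδ₀, hfeet⟩ := hW D hrectD (rb_reverse_oriented R D hDc hDb hcw) (rz / 8) (by positivity)
  refine ⟨r / 2, by positivity, min (min δ₀ (rz / 8)) (r₀ / 10), lt_min (lt_min hδ₀ (by positivity)) (by positivity), ?_⟩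
  intro δ hδ hδ₁ v hv hvτ V hV v' hv'
  obtain ⟨τ, hτ, hvτ⟩ := hvτ
  have hδδ₀ : δ < δ₀ := lt_of_lt_of_le hδ₁ ((min_le_left _ _).trans (min_le_left _ _))
  have hδrz : δ < rz / 8 := lt_of_lt_of_le hδ₁ ((min_le_left _ _).trans (min_le_right _ _))
  have hδr₀ : δ < r₀ / 10 := lt_of_lt_of_le hδ₁ (min_le_right _ _)
  have hrδ : 40 * δ ≤ r := by linarith
  -- the lattice polygon in the three vocabularies
  have hVD' : ∀ x : ℤ × ℤ, x ∈ V ↔ ((x.1 : ℂ) * ((δ : ℝ) : ℂ) + (x.2 : ℂ) * ((δ : ℝ) : ℂ) * Complex.I) ∈ closure D.carrier :=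
    fun x => by rw [hV x, hDc]
  have hVD : ∀ x : ℤ × ℤ, x ∈ V ↔ meshPoint δ (![x.1, x.2] : Site 2) ∈ closure D.carrier := fun x => by
    rw [hVD' x, rb_mesh_eq]
  have hVR : ∀ x : ℤ × ℤ, x ∈ V ↔ meshPoint δ (![x.1, x.2] : Site 2) ∈ closure R.carrier := fun x => by
    rw [hVD x, hDc]
  -- the window point and the anchor
  obtain ⟨-, hcl₀, hop₀, -, hnear₀, -⟩ := hwin τ hτ (R.mark 0 + R.mark 3 - τ) (by rw [sub_self, abs_zero]; exact hθ.le)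
  have hc₀ : D.boundary (R.mark 0 + R.mark 3 - τ) = R.boundary τ := by
    rw [hDb]; congr 1; ring
  have hvd : dist (meshPoint δ v) (D.boundary (R.mark 0 + R.mark 3 - τ)) ≤ r / 2 := by rw [hc₀]; exact hvτ
  obtain ⟨X, tv, hXv, ⟨hXV, hXout, hXcard, hXod⟩, hdsucc, hXn, hvn, htv₀, hfoot, hcw', hXt, hXdist, hdXv⟩ :=
    rb_window_anchor R D hDc hδ hrδ hVD hcl₀ hop₀ hnear₀ htabw hk₀w hv hvd
  obtain ⟨-, hclw, hopw, hTw, -, ⟨hsepb, hsepa, hsepd⟩, hAd, hAw, hCne₂, hu⟩ := hwin τ hτ tv htv₀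
  -- the boundary cycle at mesh `δ`, re-started at `d₀ = (X, kw)`
  obtain ⟨P, e', F', hP, hper', hsucc', hext', henum', hnodup', hFmono', -, hFP', hFclose', -, hcard2', hcorner'⟩ :=
    hfeet δ hδ hδδ₀ V hVD'
  have hd₀ : ((X, kw) : Dart).1 ∈ V ∧ dartTip ((X, kw) : Dart) ∉ V := ⟨hXV, hXout⟩
  obtain ⟨e, F, h0, hsucc, hper, hext, henum, hnodup, hFmono, hFP, hFclose, hF0v, hcard2, hcorner⟩ :=
    rb_cycle_shift D hper' hsucc' hext' henum' hnodup' hFmono' hFP' hFclose' hcard2' hcorner' hd₀ htube hXdist (by linarith)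
  obtain ⟨tX, hF0, htv⟩ : ∃ tX : ℝ, |F 0 - tX| < ε₂ ∧ tX ≤ tv ∧ tv ≤ tX + ε₂ := by
    rcases le_total (F 0) tv with h | h
    · refine ⟨F 0, by rw [sub_self, abs_zero]; exact hε₂, h, ?_⟩
      rw [abs_lt] at hF0v; linarith
    · exact ⟨tv, hF0v, le_rfl, by linarith⟩
  obtain ⟨N, hN1, hN2⟩ := rb_exists_steps hδ (a := 3 * (rz / 8)) (b := rz) (by positivity) (by linarith)
  have hgap : tX + 5 * θ' ≤ tb ∧ tb + 5 * θ' ≤ ta ∧ ta + 5 * θ' ≤ td ∧ td + 5 * θ' ≤ tX + 1 := by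
    have h := htv₀; rw [abs_le] at h
    refine ⟨?_, ?_, ?_, ?_⟩ <;> linarith [hτ.1, hτ.2]
  have hfar : ∀ c : ℂ, r ≤ dist c (D.boundary tv) → r / 2 ≤ dist (meshPoint δ (![X.1, X.2] : Site 2)) c :=
    fun c hc => rb_far_of_sep hrδ hXdist hc
  -- the two blocks and the clauses
  obtain ⟨ib, ia, id, hib3, hibia, hiaid, hidP, -, -, -, -, -, -, hnb, hna, hnd, hdistb, hdista, hdistd,
      hcard0, hcard1, hcardb, hcarda, hcardd, he1, -, harc, htail⟩ :=
    rb_main_blocks R D hDc (N := N) hδ (by positivity : (0 : ℝ) < rz / 8) hVD hP hsucc hper hext henum hnodup hFmono hFP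
      hFclose hF0 htv hcw' hclw hopw rfl hclb hopb rfl hcla hopa rfl hcld hopd htabw hk₀w htabb hk₀b htaba hk₀a htabd hk₀d
      hsw hsb hsa hsd hsTw hsTb hsTa hsTd hTw hTb hTa hTd ⟨hε₂θ', hθ'θ⟩ hunif htube (by linarith) hN1 hN2 hrzr hrδ hgap
      h0 hXn hXdist hXt (hfar _ hsepb) (hfar _ hsepa) (hfar _ hsepd) hsepb hsad hAb hAa hAd hAw hCne₁ hCne₂
  have hv1 : (e 1).1 = ((v 0, v 1) : ℤ × ℤ) := by rw [he1, hXv]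
  obtain ⟨hrowA, hrowB, hcorA, hcorB, hne⟩ := rb_main_clauses R hδ hVR hP hsucc hper hext henum hnodup hcard2 hcorner
    (ec_chart_of_small D hδ hVD' (by linarith) hcharts) hv1 hib3 hibia hiaid hidP hcard0 hcard1 hcardb hcarda hcardd harc htail
    (rb_rowArc_iff R D hDc hDb htb hta δ) (rb_rowBeyond_iff R D hDc hDb h1₂ h3₂ hclR hopR hδ (by linarith) hv hvn htd hu hfoot)
  -- transcription
  have hit : ∀ i, (dsucc V)^[i] ((X, kw) : Dart) = e i := fun i => by rw [← h0, rb_iterate_eq hsucc, zero_add]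
  have hPer : period V ((X, kw) : Dart) = P := by rw [← h0]; exact rb_period_eq hP hsucc hper hext hnodup
  have hvcard : ((neighbours ((v 0, v 1) : ℤ × ℤ)).filter (fun y ↦ y ∉ V)).card = 1 := ((rb_mem_boundaryRow_iff R hδ hVR v).1 hv).2
  simp only [h0] at hrowB hne
  subst hv'
  refine ⟨(X, kw), ib, ia, id, ?_⟩
  simp only [hit, hPer]
  refine ⟨⟨hXV, hXout, hXod⟩, by rw [hdsucc], ⟨by omega, hibia.le, by omega, by omega⟩, ⟨hXcard, hcardb, hcarda, hcardd, hvcard⟩,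
    ⟨rb_sep_of_far hδ hXdist hdistb (by rw [dist_comm]; linarith), rb_sep_of_far hδ hXdist hdista (by rw [dist_comm]; linarith),
      rb_sep_of_far hδ hXdist hdistd (by rw [dist_comm]; linarith), rb_sep_of_far hδ hdistb hdista (by linarith),
      rb_sep_of_far hδ hdistb hdistd (by linarith), rb_sep_of_far hδ hdista hdistd (by linarith)⟩,
    hrowA, hrowB, hcorA, hcorB, hne, rb_ne_of_dist_ne (by rw [hdXv]; exact hδ.ne'), ?_, ?_⟩
  · rw [rb_mesh_eq, rb_mesh_eq, rb_mesh_eq, rb_mesh_eq, ← hDb1, ← hDa0, ← hDd3]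
    exact ⟨hdXv.le, by linarith [hdistb.le], by linarith [hdista.le], by linarith [hdistd.le]⟩
  · intro x hx
    simp only [Finset.mem_insert, Finset.mem_singleton] at hx
    have hρ : (0 : ℝ) ≤ r / 2 := by positivity
    rcases hx with rfl | rfl | rfl | rfl
    · exact ⟨dvw, hdvw, rb_flat_at hVD hδ hρ hclw hdw hXn (by linarith)⟩
    · exact ⟨dvb, hdvb, rb_flat_at hVD hδ hρ hclb hdb hnb (by linarith)⟩
    · exact ⟨dva, hdva, rb_flat_at hVD hδ hρ hcla hda hna (by linarith)⟩
    · exact ⟨dvd, hdvd, rb_flat_at hVD hδ hρ hcld hdd hnd (by linarith)⟩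

end Summit.CriticalPhenomena.CardyFormulaZ2.Cruxes.RectilinearCardy.ExcursionKernelCovariance

end
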